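import Literature.MathematicalPhysics.QuantumFieldTheory.Balaban1983to89.B15TreeGaugeT0Stokes

/-!
# `Balaban1983to89.B15TreeGaugeT0LevelChange` — T. Bałaban, *Large field renormalization. I. The basic step of the 𝐑 operation*, Commun. Math. Phys. **122** (1989) 175–202 [Balaban1989LargeFieldI], p. 196 (the tree gauge `T₀` on `𝐁₀`): the two-level comparison of `T₀`-paths, case `x′₁ > a` (both contours take the detour around the inner domain) and the combined statement (PART 5b of this unit's transport reading)

statement-level skeleton of published theorems with citation tags; proofs where landed; nothing here is a claim about the Yang–Mills mass gap

PDF held: `paper:balaban1989-cmp122-large-field-i` (journal page = PDF page + 174; p. 196 = PDF p. 22, text layer re-read for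
this file); [Balaban1989LargeFieldII] = `paper:balaban1989-cmp122-large-field-ii` (p. 382 = PDF p. 28).

WHAT IS REPRODUCED (mega-formalization `lit-balaban`, HOME `run/shared/lean/pub/lit-balaban/`, Phase-2 seat p26, generation 5;
SKELETON row **B15.Claim@196** (*"We can prove that it satisfies |V′ − 1| < O(1)M²NR_k⁴ε_k on 𝐁₀"*, p. 196; NO PROOF IS
PRINTED), served by PART 6 `B15Claim196T0`; referee ref-5).  Continuation of PART 5a `B15TreeGaugeT0Stokes` (ratio
bookkeeping, interleaving lemma, case `x′₁ ≦ a`).  Here: **`norm_levelChange_detour_le`** — for two consecutive pairs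
`(P₁,P₂)`, `(P₂,P₃)` with the p. 196 geometry and a common threshold `a`, a `U1`-valued `V` with `ε`-small plaquettes on
`P₁∖P₃`, and `x′ ∈ P₂∖P₃` with `x′₁ > a` (both `Γ^{P₂}_{y′,x′}` and `Γ^{P₁}_{y,x′}` take the detour of p. 196):
`‖V(treeWord(y′ − y) ∪ Γ^{P₂}_{x′})·V(Γ^{P₁}_{x′})⁻¹ − 1‖ ≤ (d² + 2)W²ε`; and the combined **`norm_levelChange_sub_one_le`**
(both cases), the input of PART 6 for the bonds of `𝐁₀` joining two consecutive layers.

THE PROOF (this seat's).  Write `y, y′` for the corners of `P₁, P₂`, `(b₁ − 1/2), (b′₁ − 1/2)` for their far faces in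
direction `1`.  The `T₀`-path is `treeWord(y′ − y) ∪ tw_H(x′ − y′) ∪ [y′₁ → b′₁ − 1/2]₁ ∪ [y′₂ → x′₂]₂ ∪ [b′₁ − 1/2 → x′₁]₁`,
the merged contour is `tw_H(x′ − y) ∪ [y₁ → b₁ − 1/2]₁ ∪ [y₂ → x′₂]₂ ∪ [b₁ − 1/2 → x′₁]₁` (`H` = the high directions
`d, …, 3`).  STEP 1: `treeWord(y′ − y) ∪ tw_H(x′ − y′) = tw_D(a) ∪ tw_D(b̂)` (`b̂` = high part of `x′ − y′`) is replaced by
`tw_D(a + b̂) = tw_H(x′ − y) ∪ [y₂ → y′₂]₂ ∪ [y₁ → y′₁]₁` by the interleaving lemma of PART 5a in the slab `y ≤ z ≤ (a′₁, a′₂,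
x′₃, …)` ⊂ `P₁∖P₃` (`≤ d²W²ε`).  STEP 2: in the `(1,2)`-plane at the high coordinates of `x′`, `[y₂ → y′₂]₂ ∪ [y₁ → b′₁ −
1/2]₁` is swapped to `[y₁ → b′₁ − 1/2]₁ ∪ [y₂ → y′₂]₂` — the rectangle `[y₁, b′₁ − 1/2] × [y₂, y′₂]`, below `P₃` in direction
`2` (`≤ W²ε`, PART 1's wide ladder).  STEP 3: the common last segment `[b′₁ − 1/2 → x′₁]₁` aside, `[y₂ → x′₂]₂` at `b′₁ −
1/2` against `[b′₁ − 1/2 → b₁ − 1/2]₁ ∪ [y₂ → x′₂]₂ ∪ [b₁ − 1/2 → b′₁ − 1/2]₁` is the rectangle `[b′₁ − 1/2, b₁ − 1/2] × [y₂,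
x′₂]`, beyond `P₃` in direction `1` (`≤ W²ε`).  Total `(d² + 2)W²ε` by `norm_ratio_trans`.

HONEST SCOPE.  As PART 5a: one unit lattice `ℤ^{n+3}` (`d = n + 3 ≥ 3`), `U1 𝔸`-valued bond fields, `≤`-hypotheses; the
constant is this proof's (the print states no proof).  Every declaration is a proved lemma; nothing of [IV]/[V] is asserted.
Unit `lit-balaban-p26` (literature-prover-lit-balaban-p26-g5-0).
-/

noncomputable section

open scoped BigOperators

namespace Literature.MathematicalPhysics.QuantumFieldTheory.Balaban1983to89.B16Ineq382

open B7Prop1Explicit B8Lemma1NonAbelian B15TreeGauge196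

/-! ## §4 (continued) The two-level comparison: case `x′₁ > a`, and the combined statement -/

section TwoLevel

variable {n : ℕ} {𝔸 : Type*} [NormedRing 𝔸] [NormOneClass 𝔸]
variable {lo hi lo' hi' lo'' hi'' : Site (n + 3)} {τ : ℤ} {W : ℕ} {V : Site (n + 3) → Fin (n + 3) → 𝔸ˣ} {ε : ℝ}

/-- **Two-level comparison, case `x′₁ > a`** (both contours take the detour): `‖V(treeWord(y′ − y) ∪ Γ^{P₂}_{x′}) ·
V(Γ^{P₁}_{x′})⁻¹ − 1‖ ≤ (d² + 2)W²ε` — the high directions are interleaved in the slab `z₁ ≤ a′₁` (`≤ d²W²ε`); after the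
common last `1`-segment is split off, what remains in the `(1,2)`-plane at the high coordinates of `x′` is the boundary of
the rectangle `[y₁, b′₁ − 1/2] × [y₂, y′₂]` (below `P₃` in direction `2`) followed by that of `[b′₁ − 1/2, b₁ − 1/2] ×
[y₂, x′₂]` (beyond `P₃` in direction `1`), `≤ W²ε` each. [cite: Balaban1989LargeFieldI, p.196] -/
theorem norm_levelChange_detour_le (hGo : Geom lo hi lo' hi' τ) (hGi : Geom lo' hi' lo'' hi'' τ)
    (hW : ∀ κ, hi κ - lo κ ≤ W) (hV : ∀ x κ, V x κ ∈ U1 𝔸) (hε : 0 ≤ ε)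
    (hP : PlaqSmallOn (ann lo hi lo'' hi'') V ε) {x' : Site (n + 3)} (hx' : x' ∈ ann lo' hi' lo'' hi'')
    (hxτ : ¬ x' i0 ≤ τ) :
    ‖((hol V lo (treeWord (lo' - lo) ++ contour lo' hi' τ x') * (hol V lo (contour lo hi τ x'))⁻¹ : 𝔸ˣ) : 𝔸) - 1‖ ≤
      (((n : ℝ) + 3) ^ 2 + 2) * (W : ℝ) ^ 2 * ε := by
  have hxb := mem_box_iff.mp hx'.1
  have hhigh : ∀ κ : Fin (n + 3), 2 ≤ κ.val → lo κ ≤ x' κ ∧ x' κ ≤ hi κ := fun κ _ =>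
    ⟨(hGo.lo_lt κ).le.trans (hxb κ).1, (hxb κ).2.trans (hGo.lt_hi κ).le⟩
  have hl0 := hGo.lo_lt i0; have hl1 := hGo.lo_lt i1; have hh0 := hGo.lt_hi i0; have hh1 := hGo.lt_hi i1
  have hx0 := hxb i0; have hx1 := hxb i1; have hW0 := hW i0; have hW1 := hW i1
  have hil1 := hGi.lo_lt i1; have hih0 := hGi.lt_hi i0
  -- the natural numbers `α₁ = y′₂ − y₂`, `β₁ = x′₂ − y′₂`, `M′ = b′₁ − 1/2 − y₁`, `δ = b₁ − b′₁`, `k′ = b′₁ − 1/2 − x′₁`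
  obtain ⟨α₁, hα₁⟩ := Int.eq_ofNat_of_zero_le (show 0 ≤ lo' i1 - lo i1 by omega)
  obtain ⟨β₁, hβ₁⟩ := Int.eq_ofNat_of_zero_le (show 0 ≤ x' i1 - lo' i1 by omega)
  obtain ⟨M', hM'⟩ := Int.eq_ofNat_of_zero_le (show 0 ≤ hi' i0 - lo i0 by omega)
  obtain ⟨δ, hδ⟩ := Int.eq_ofNat_of_zero_le (show 0 ≤ hi i0 - hi' i0 by omega)
  obtain ⟨k', hk'⟩ := Int.eq_ofNat_of_zero_le (show 0 ≤ hi' i0 - x' i0 by omega)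
  -- the vectors `a = y′ − y` and the high part `b̂` of `b = x′ − y′`
  set bh : Site (n + 3) := restrict (highDirs n) (x' - lo') with hbh
  have haW : ∀ κ ∈ (List.finRange (n + 3)).reverse, 0 ≤ (lo' - lo) κ ∧ (lo' - lo) κ ≤ W := fun κ _ => by
    have h1 := hGo.lo_lt κ; have h2 := hGo.lt_hi κ; have h3 := (hxb κ).1; have h4 := (hxb κ).2; have h5 := hW κ
    simp only [Pi.sub_apply]; constructor <;> omega
  have hbhW : ∀ κ ∈ (List.finRange (n + 3)).reverse, 0 ≤ bh κ ∧ bh κ ≤ W := fun κ _ => by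
    by_cases hκ : κ ∈ highDirs n
    · have h1 := hGo.lo_lt κ; have h2 := hGo.lt_hi κ; have h3 := (hxb κ).1; have h4 := (hxb κ).2; have h5 := hW κ
      rw [hbh, restrict_apply_of_mem hκ, Pi.sub_apply]; constructor <;> omega
    · rw [hbh, restrict_apply_of_not_mem hκ]; exact ⟨le_rfl, by positivity⟩
  -- base points
  have hq₀ : lo + disp (tw (highDirs n) (x' - lo)) = pt (lo i0) (lo i1) x' := by
    rw [disp_tw highDirs_nodup, add_restrict_highDirs]
  have hr : lo + disp (tw (highDirs n) (x' - lo) ++ seg i0 (M' : ℤ)) = pt (lo i0 + M') (lo i1) x' := by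
    rw [disp_append, ← add_assoc, hq₀, disp_seg, pt_add_e0]
  -- THE WORDS.  W₀ = [] ∪ (tw D a ∪ tw D b̂) ∪ detourTail′
  have eW0 : treeWord (lo' - lo) ++ contour lo' hi' τ x' = [] ++ (tw (List.finRange (n + 3)).reverse (lo' - lo) ++
      tw (List.finRange (n + 3)).reverse bh) ++ detourTail lo' hi' x' := by
    rw [contour_of_not_le hxτ, ← tw_finRange_restrict_highDirs (x' - lo'), ← hbh, treeWord_eq_tw, List.nil_append,
      List.append_assoc]
  -- W₁ = [] ∪ tw D (a + b̂) ∪ detourTail′ = tw H (x′ − y) ∪ ([α₁ e₂] ∪ [M′ e₁]) ∪ ([β₁ e₂] ∪ [−k′ e₁])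
  have hvH : tw (highDirs n) ((lo' - lo) + bh) = tw (highDirs n) (x' - lo) := tw_congr fun κ hκ => by
    rw [Pi.add_apply, hbh, restrict_apply_of_mem hκ, Pi.sub_apply, Pi.sub_apply, Pi.sub_apply]; ring
  have hv1 : ((lo' - lo) + bh) i1 = (α₁ : ℤ) := by
    rw [Pi.add_apply, hbh, restrict_apply_of_not_mem i1_not_mem_highDirs, add_zero, Pi.sub_apply, hα₁]
  have hv0 : ((lo' - lo) + bh) i0 = lo' i0 - lo i0 := by
    rw [Pi.add_apply, hbh, restrict_apply_of_not_mem i0_not_mem_highDirs, add_zero, Pi.sub_apply]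
  have hsegM : (seg i0 (lo' i0 - lo i0) : List (Letter (n + 3))) ++ seg i0 (hi' i0 - lo' i0) = seg i0 (M' : ℤ) := by
    rw [← seg_add_of_nonneg i0 (by omega) (by omega), ← hM']; congr 1; ring
  have eW1 : [] ++ tw (List.finRange (n + 3)).reverse ((lo' - lo) + bh) ++ detourTail lo' hi' x' =
      tw (highDirs n) (x' - lo) ++ (seg i1 (α₁ : ℤ) ++ seg i0 (M' : ℤ)) ++ (seg i1 (β₁ : ℤ) ++ seg i0 (-(k' : ℤ))) := by
    rw [List.nil_append, ← treeWord_eq_tw, treeWord_eq, hvH, hv1, hv0, detourTail, hβ₁,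
      show x' i0 - hi' i0 = -(k' : ℤ) by omega, ← hsegM]
    simp only [List.append_assoc]
  -- W₂ = tw H (x′ − y) ∪ ([M′ e₁] ∪ [α₁ e₂]) ∪ ([β₁ e₂] ∪ [−k′ e₁]) = (tw H (x′ − y) ∪ [M′ e₁]) ∪ [(α₁+β₁) e₂] ∪ [−k′ e₁]
  have eW2 : tw (highDirs n) (x' - lo) ++ (seg i0 (M' : ℤ) ++ seg i1 (α₁ : ℤ)) ++ (seg i1 (β₁ : ℤ) ++ seg i0 (-(k' : ℤ))) =
      (tw (highDirs n) (x' - lo) ++ seg i0 (M' : ℤ)) ++ seg i1 ((α₁ : ℤ) + β₁) ++ seg i0 (-(k' : ℤ)) := by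
    rw [seg_add_of_nonneg i1 (by positivity) (by positivity)]
    simp only [List.append_assoc]
  -- W₃ = Γ^{P₁}_{x′} = (tw H (x′ − y) ∪ [M′ e₁]) ∪ ([δ e₁] ∪ [(α₁+β₁) e₂] ∪ [−δ e₁]) ∪ [−k′ e₁]
  have eW3 : contour lo hi τ x' = (tw (highDirs n) (x' - lo) ++ seg i0 (M' : ℤ)) ++
      (seg i0 (δ : ℤ) ++ seg i1 ((α₁ : ℤ) + β₁) ++ seg i0 (-(δ : ℤ))) ++ seg i0 (-(k' : ℤ)) := by
    rw [contour_of_not_le hxτ, detourTail, show hi i0 - lo i0 = (M' : ℤ) + δ by omega,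
      show x' i1 - lo i1 = (α₁ : ℤ) + β₁ by omega, show x' i0 - hi i0 = -((δ : ℤ) + k') by omega,
      seg_add_of_nonneg i0 (by positivity) (by positivity), seg_neg_add_of_nonneg i0 δ k']
    simp only [List.append_assoc]
  -- STEP 1: the interleaving of the high directions, in the slab `y ≤ z ≤ (a′₁, a′₂, x′₃, …)` ⊂ P₁ ∖ P₃
  have hEH : ∀ κ, κ ∈ highDirs n → (lo + restrict (List.finRange (n + 3)).reverse ((lo' - lo) + bh)) κ = x' κ := by
    intro κ hκ
    rw [restrict_finRange_reverse, Pi.add_apply, Pi.add_apply, hbh, Pi.sub_apply, restrict_apply_of_mem hκ,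
      Pi.sub_apply]
    ring
  have hEL : ∀ κ, κ ∉ highDirs n → (lo + restrict (List.finRange (n + 3)).reverse ((lo' - lo) + bh)) κ = lo' κ := by
    intro κ hκ
    rw [restrict_finRange_reverse, Pi.add_apply, Pi.add_apply, hbh, Pi.sub_apply, restrict_apply_of_not_mem hκ]
    ring
  have hbox : ∀ z : Site (n + 3), lo ≤ z → z ≤ lo + restrict (List.finRange (n + 3)).reverse ((lo' - lo) + bh) →
      z ∈ ann lo hi lo'' hi'' := by
    intro z hz1 hz2
    have hz0 : z i0 ≤ lo' i0 := by have h := hz2 i0; rwa [hEL i0 i0_not_mem_highDirs] at h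
    refine ⟨mem_box_iff.mpr fun κ => ⟨hz1 κ, ?_⟩, not_mem_box_of_lt i0 (lt_of_le_of_lt hz0 (hGi.lo_lt i0))⟩
    have h2 := hGo.lt_hi κ; have h3 := (hxb κ).1; have h4 := (hxb κ).2
    by_cases hκ : κ ∈ highDirs n
    · have h : z κ ≤ x' κ := by have h := hz2 κ; rwa [hEH κ hκ] at h
      omega
    · have h : z κ ≤ lo' κ := by have h := hz2 κ; rwa [hEL κ hκ] at h
      omega
  have key := norm_hol_tw_append_tw_le hV hP hε W _ finRange_reverse_nodup (lo' - lo) bh lo haW hbhW hbox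
  rw [List.length_reverse, List.length_finRange] at key
  simp only [Nat.cast_add, Nat.cast_ofNat] at key
  have hrep1 := norm_replace_le hV (p := lo) (w₁ := []) (w₂ := detourTail lo' hi' x')
    (u := tw (List.finRange (n + 3)).reverse (lo' - lo) ++ tw (List.finRange (n + 3)).reverse bh)
    (u' := tw (List.finRange (n + 3)).reverse ((lo' - lo) + bh)) (δ := ((n : ℝ) + 3) ^ 2 * (W : ℝ) ^ 2 * ε)
    (by rw [disp_append, disp_tw finRange_reverse_nodup, disp_tw finRange_reverse_nodup,
      disp_tw finRange_reverse_nodup, restrict_add]) (by rw [disp_nil, add_zero]; exact key)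
  rw [eW1] at hrep1
  -- STEP 2: the rectangle `[y₁, b′₁ − 1/2] × [y₂, y′₂]` (swap `[α₁ e₂] ∪ [M′ e₁] ↦ [M′ e₁] ∪ [α₁ e₂]`)
  have loc2 : ‖((hol V (lo + disp (tw (highDirs n) (x' - lo))) (seg i1 (α₁ : ℤ) ++ seg i0 (M' : ℤ)) *
      (hol V (lo + disp (tw (highDirs n) (x' - lo))) (seg i0 (M' : ℤ) ++ seg i1 (α₁ : ℤ)))⁻¹ : 𝔸ˣ) : 𝔸) - 1‖ ≤
        M' * ((seg i1 (α₁ : ℤ) : List (Letter (n + 3))).length * ε) := by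
    rw [hq₀]
    refine norm_swap_le hV hP i0 (seg i1 (α₁ : ℤ)) (fun l hl => by rw [mem_seg hl]; exact i1_ne_i0) M' _
      fun j hj => ?_
    rw [pt_add_e0, pathIn_seg_natCast]
    intro t ht
    rw [pt_add_e1]
    exact ⟨pt_mem_box_iff.mpr ⟨⟨by omega, by omega⟩, ⟨by omega, by omega⟩, hhigh⟩,
      not_mem_box_of_lt i1 (by rw [pt_i1]; omega)⟩
  have hrep2 := norm_replace_le hV (p := lo) (w₁ := tw (highDirs n) (x' - lo))
    (w₂ := seg i1 (β₁ : ℤ) ++ seg i0 (-(k' : ℤ))) (u := seg i1 (α₁ : ℤ) ++ seg i0 (M' : ℤ))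
    (u' := seg i0 (M' : ℤ) ++ seg i1 (α₁ : ℤ)) (by rw [disp_append, disp_append]; exact add_comm _ _) loc2
  rw [eW2] at hrep2
  -- STEP 3: the rectangle `[b′₁ − 1/2, b₁ − 1/2] × [y₂, x′₂]` (the path `[(α₁+β₁) e₂]` conjugated by `[δ e₁]`)
  have loc3 : ‖((hol V (lo + disp (tw (highDirs n) (x' - lo) ++ seg i0 (M' : ℤ))) (seg i1 ((α₁ : ℤ) + β₁)) *
      (hol V (lo + disp (tw (highDirs n) (x' - lo) ++ seg i0 (M' : ℤ)))
        (seg i0 (δ : ℤ) ++ seg i1 ((α₁ : ℤ) + β₁) ++ seg i0 (-(δ : ℤ))))⁻¹ : 𝔸ˣ) : 𝔸) - 1‖ ≤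
        δ * ((seg i1 ((α₁ : ℤ) + β₁) : List (Letter (n + 3))).length * ε) := by
    rw [hr]
    refine norm_conj_seg_ratio_le hV hP i0 (seg i1 ((α₁ : ℤ) + β₁)) (fun l hl => by rw [mem_seg hl]; exact i1_ne_i0)
      δ _ fun j hj => ?_
    rw [pt_add_e0, show ((α₁ : ℤ) + β₁) = ((α₁ + β₁ : ℕ) : ℤ) by push_cast; rfl, pathIn_seg_natCast]
    intro t ht
    rw [pt_add_e1]
    exact ⟨pt_mem_box_iff.mpr ⟨⟨by omega, by omega⟩, ⟨by omega, by omega⟩, hhigh⟩,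
      not_mem_box_of_gt i0 (by rw [pt_i0]; omega)⟩
  have hrep3 := norm_replace_le hV (p := lo) (w₁ := tw (highDirs n) (x' - lo) ++ seg i0 (M' : ℤ))
    (w₂ := seg i0 (-(k' : ℤ))) (u := seg i1 ((α₁ : ℤ) + β₁))
    (u' := seg i0 (δ : ℤ) ++ seg i1 ((α₁ : ℤ) + β₁) ++ seg i0 (-(δ : ℤ)))
    (by simp only [disp_append, disp_seg, neg_zsmul]; abel) loc3
  -- assembling
  rw [eW0, eW3]
  have htot := norm_ratio_trans (hol_mem hV _ _) (hol_mem hV _ _)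
    (norm_ratio_trans (hol_mem hV _ _) (hol_mem hV _ _) hrep1 hrep2) hrep3
  refine htot.trans ?_
  -- arithmetic: `M′, δ ≤ W`, `α₁ ≤ W`, `α₁ + β₁ ≤ W`
  rw [length_seg, length_seg, Int.natAbs_natCast, show ((α₁ : ℤ) + β₁).natAbs = α₁ + β₁ by omega]
  have hM'Z : (M' : ℤ) ≤ W := by omega
  have hδZ : (δ : ℤ) ≤ W := by omega
  have hαZ : (α₁ : ℤ) ≤ W := by omega
  have hαβZ : ((α₁ + β₁ : ℕ) : ℤ) ≤ W := by push_cast; omega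
  have hM'W : (M' : ℝ) ≤ W := by exact_mod_cast hM'Z
  have hδW : (δ : ℝ) ≤ W := by exact_mod_cast hδZ
  have hαW : (α₁ : ℝ) ≤ W := by exact_mod_cast hαZ
  have hαβW : ((α₁ + β₁ : ℕ) : ℝ) ≤ W := by exact_mod_cast hαβZ
  have hWn : (0 : ℝ) ≤ W := Nat.cast_nonneg _
  have h2 : (M' : ℝ) * ((α₁ : ℝ) * ε) ≤ W * (W * ε) :=
    mul_le_mul hM'W (mul_le_mul_of_nonneg_right hαW hε) (by positivity) hWn
  have h3 : (δ : ℝ) * (((α₁ + β₁ : ℕ) : ℝ) * ε) ≤ W * (W * ε) :=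
    mul_le_mul hδW (mul_le_mul_of_nonneg_right hαβW hε) (by positivity) hWn
  push_cast at h3 ⊢
  nlinarith [h2, h3]

/-- **THE TWO-LEVEL COMPARISON.**  For two consecutive pairs `(P₁,P₂) = ([lo,hi],[lo′,hi′])`, `(P₂,P₃) = ([lo′,hi′],
[lo″,hi″])` of the chain with the p. 196 geometry and a common threshold, sides of `P₁` of at most `W + 1` sites, a
`U1`-valued `V` whose plaquettes with corners in the merged annulus `P₁∖P₃` are `ε`-small, and a site `x′ ∈ P₂∖P₃`: the
transport along the `T₀`-path `treeWord (y′ − y) ∪ Γ^{P₂}_{y′,x′}` (through the tree of `P₁∖P₂`, the external bond of `P₂`,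
then the contour of the pair `(P₂,P₃)`) and along the contour `Γ^{P₁}_{y,x′}` of the merged pair `(P₁,P₃)` differ by
`‖V(T₀-path)·V(Γ^{P₁}_{y,x′})⁻¹ − 1‖ ≤ (d² + 2)W²ε`. [cite: Balaban1989LargeFieldI, p.196] -/
theorem norm_levelChange_sub_one_le (hGo : Geom lo hi lo' hi' τ) (hGi : Geom lo' hi' lo'' hi'' τ)
    (hW : ∀ κ, hi κ - lo κ ≤ W) (hV : ∀ x κ, V x κ ∈ U1 𝔸) (hε : 0 ≤ ε)
    (hP : PlaqSmallOn (ann lo hi lo'' hi'') V ε) {x' : Site (n + 3)} (hx' : x' ∈ ann lo' hi' lo'' hi'') :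
    ‖((hol V lo (treeWord (lo' - lo) ++ contour lo' hi' τ x') * (hol V lo (contour lo hi τ x'))⁻¹ : 𝔸ˣ) : 𝔸) - 1‖ ≤
      (((n : ℝ) + 3) ^ 2 + 2) * (W : ℝ) ^ 2 * ε := by
  by_cases hxτ : x' i0 ≤ τ
  · refine (norm_levelChange_usual_le hGo hGi hW hV hε hP hx' hxτ).trans ?_
    have : (0 : ℝ) ≤ 2 * (W : ℝ) ^ 2 * ε := by positivity
    nlinarith
  · exact norm_levelChange_detour_le hGo hGi hW hV hε hP hx' hxτ


end TwoLevel

end Literature.MathematicalPhysics.QuantumFieldTheory.Balaban1983to89.B16Ineq382
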